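import Mathlib
import HarnessLib

/-!
# Crux `NNLinearDegreeCofactorHard` (stmt-ValiantsHypothesis-23918), line `internal_cofactor`: arithmetic glue from the
# pricing of respecting words to the COUNTS (LEAD p2's assembly unit, LEAD-HANDOFF §p2)

The counts demanded by `InternalCofactor.denseInternalHard_of_counts` / `lt_complexity_of_counts` (p3) have the shape
`4·(K+1)·(m+1)² · #{y ∈ BB : f y respects S} < #BB`.  The μ* programme delivers, per balanced split `S`, a PRICING
`#(BB ∩ Resp S) · (4/3)^r ≤ 2^J` (`CondProbBits.card_mul_le_of_passages`, p599940, with `r ≤` tests + passages from the heart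
(D*)/U5) and a BAND count `2^J ≤ 2 · #BB` (`…ShedWordBand`).  This file is the two-line arithmetic in between, once and for all:

* `counts_of_pricing` — from the three displayed inequalities and `8·(K+1)·(m+1)²·(3/4)^r < 1` to the count;
* `counts_of_pricing'` — the same with the pricing stated as `good ≤ 2^J · (3/4)^r`.

Honest framing: arithmetic only; the pricing, the band and the eventual inequality in `n` (`stub_params`-sized) are NOT here;
nothing here proves S2b, the crux or VP ≠ VNP.  No definitions, no named facts.
-/

-- Sub = Summit single-conjunct layout: the duplicated namespace component is mandated by the tree.
set_option linter.dupNamespace false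

namespace Summit.ValiantsHypothesis.ValiantsHypothesis.Theorems.FifoMatching.NNLinearDegreeCofactorHard.CondProbBits

/-- **Counts from pricing.**  If `good · (4/3)^r ≤ 2^J` (pricing of the respecting good words), `2^J ≤ 2 · B` (at least half
of all words are good) and `8 (K+1) (m+1)² (3/4)^r < 1` (the parameters beat the threshold), then
`4 (K+1) (m+1)² · good < B`. [folklore] -/
theorem counts_of_pricing {J B good K m r : ℕ}
    (hgood : (good : ℝ) * (4 / 3 : ℝ) ^ r ≤ 2 ^ J) (hB : (2 : ℝ) ^ J ≤ 2 * B)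
    (har : (8 * (K + 1) * (m + 1) ^ 2 : ℝ) * (3 / 4 : ℝ) ^ r < 1) :
    4 * (K + 1) * (m + 1) ^ 2 * good < B := by
  have h43 : (0 : ℝ) < (4 / 3 : ℝ) ^ r := by positivity
  have h34 : (3 / 4 : ℝ) ^ r * (4 / 3 : ℝ) ^ r = 1 := by
    rw [← mul_pow]; norm_num
  -- `good ≤ 2 B (3/4)^r`
  have hg : (good : ℝ) ≤ 2 * B * (3 / 4 : ℝ) ^ r := by
    have : (good : ℝ) = (good * (4 / 3 : ℝ) ^ r) * (3 / 4 : ℝ) ^ r := by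
      rw [mul_assoc, mul_comm ((4 / 3 : ℝ) ^ r), h34, mul_one]
    rw [this]
    exact mul_le_mul_of_nonneg_right (hgood.trans hB) (by positivity)
  have hBpos : (0 : ℝ) < B := by
    have : (0 : ℝ) < 2 ^ J := by positivity
    linarith
  have key : (4 * (K + 1) * (m + 1) ^ 2 * good : ℝ) < B := by
    calc (4 * (K + 1) * (m + 1) ^ 2 * good : ℝ)
        ≤ 4 * (K + 1) * (m + 1) ^ 2 * (2 * B * (3 / 4 : ℝ) ^ r) :=
          mul_le_mul_of_nonneg_left hg (by positivity)
      _ = ((8 * (K + 1) * (m + 1) ^ 2 : ℝ) * (3 / 4 : ℝ) ^ r) * B := by ring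
      _ < 1 * B := mul_lt_mul_of_pos_right har hBpos
      _ = B := one_mul _
  exact_mod_cast key

/-- The same with the pricing written as `good ≤ 2^J · (3/4)^r`. [folklore] -/
theorem counts_of_pricing' {J B good K m r : ℕ}
    (hgood : (good : ℝ) ≤ 2 ^ J * (3 / 4 : ℝ) ^ r) (hB : (2 : ℝ) ^ J ≤ 2 * B)
    (har : (8 * (K + 1) * (m + 1) ^ 2 : ℝ) * (3 / 4 : ℝ) ^ r < 1) :
    4 * (K + 1) * (m + 1) ^ 2 * good < B := by
  refine counts_of_pricing ?_ hB har
  have h34 : (3 / 4 : ℝ) ^ r * (4 / 3 : ℝ) ^ r = 1 := by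
    rw [← mul_pow]; norm_num
  calc (good : ℝ) * (4 / 3 : ℝ) ^ r ≤ (2 ^ J * (3 / 4 : ℝ) ^ r) * (4 / 3 : ℝ) ^ r :=
        mul_le_mul_of_nonneg_right hgood (by positivity)
    _ = 2 ^ J := by rw [mul_assoc, h34, mul_one]

end Summit.ValiantsHypothesis.ValiantsHypothesis.Theorems.FifoMatching.NNLinearDegreeCofactorHard.CondProbBits
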